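import Mathlib
import HarnessLib
import Summits.Ventures.LatticeQCDFlow.Exactness.SUNMultiStepLeapfrogHMC

/-!
# `SU(N)` rung in general coordinates — the drift `e_ε(p)·V` moves a configuration by at most `N²C_ι|ε|‖p‖` in the matrix sup norm; THE WORK IDENTITY for ANY action along the drift; first-order Taylor with the explicit remainder `½N²C_ιβ|ε|K‖p‖Σ_l‖p_l‖` for a force field represented through any bounded pairing

HONEST FRAMING: exact (Metropolis-corrected) sampling algorithms for lattice gauge theory;
figures of merit are autocorrelation/cost numbers at stated couplings and volumes; no
continuum-physics claim.

Venture `LatticeQCDFlow` (cell pub-lqcd), topic `Exactness`; FANOUT row 14 (`eng-flowhmc`, engine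
`latflow.fthmc`, family B: the leapfrog drift `U_l ← expm(ε P_l) U_l` between two half kicks by the
autodiff force) — the `SU(N)` rung (rows 21–26 run `SU(3)`).  The general-coordinates twin of
`SU2ExpDriftWork` (Pauli coordinates, `N = 2`) and `U1ExactForceWork`, and the input of
`SUNLeapfrogEnergyError` (the energy error of the engine's `n`-step `SU(N)` proposal
`sunLeapfrogProposalN ι hι ε g n`).  NEW WORK of the cell over the tree: row 9's kernel of record
`SUNLeapfrogHMC` / `SUNMultiStepLeapfrogHMC` (`sunExpDrift ι hι ε p = (exp (ε ι p_l))_l` for ANY linear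
coordinates `ι : E →ₗ[ℝ] M_N(ℂ)` of `𝔰𝔲(N)` with skew-Hermitian traceless values), `SUNExpChart` (`suExp`),
`SUNProductTrajectory` (`coeConfig`, `‖U‖_{∞-op} ≤ N` on `SU(N)`), Mathlib (`hasDerivAt_exp_smul_const`, the
mean value inequality); nothing is cited as a fact; no number.  `S : (L → SU(N)) → ℝ` is ARBITRARY (any
finite link set `L`; the FT action `β S_W∘F − log J` of any member, or `β S_W`).  A FORCE FIELD
`D : (L → SU(N)) → L → E` enters only through the hypothesis that it REPRESENTS the differential of
`a ↦ S(e_ε(a)·W)` at `a = 0` through a pairing `B : E →ₗ[ℝ] E →ₗ[ℝ] ℝ`,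
`D(a ↦ S(e_ε(a)·W))(0)[δ] = Σ_l B(D(W)_l, δ_l)` — what reverse-mode autodiff returns, read through the
kinetic metric (`B = ⟪·,·⟫` on `ℝ³` for the Pauli coordinates of `SU2ExpDriftWork`; the polarisation of
`−tr P²` for the engine's `sunCoordι`); only `|B(x, y)| ≤ β‖x‖‖y‖` is used.  The coordinate map enters
only through a norm bound `‖ι x‖_{∞-op} ≤ C_ι‖x‖` (`C_ι = 2` for the Pauli coordinates by
`linfty_opNorm_su2Coord_le`; some `C_ι` always exists, `exists_norm_coords_le`).

* §1 `sunExpDrift_zero`, **`sunExpDrift_add_smul`** (`e_ε((h+s)p) = e_ε(hp)·e_ε(sp)`: the drift is a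
  one-parameter group linkwise), `exists_norm_coords_le`, `hasDerivAt_coe_suExp_smul`
  (`d/dτ exp(τ ι a) = exp(τ ι a)·ι a`), **`norm_coe_suExp_smul_sub_le`**
  (`‖exp(t ι a) − exp(t' ι a)‖_{∞-op} ≤ N·C_ι‖a‖|t − t'|`), **`norm_coeConfig_sunExpDrift_sub_le`** —
  `‖coeConfig(e_ε(tp)·V) − coeConfig(e_ε(t'p)·V)‖ ≤ N²C_ι|ε|‖p‖|t − t'|` (the constant `N·N·C_ι` from
  `‖U‖_{∞-op} ≤ N` twice; not optimised);
* §2 **`hasDerivAt_action_sunExpDrift`** — THE WORK IDENTITY, coordinate-free: if `a ↦ S(e_ε(a)·W)` is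
  differentiable at `0` for every `W`, then `d/dt|_{t=s} S(e_ε(tp)·V) = D(a ↦ S(e_ε(a)·e_ε(sp)·V))(0)[p]`
  (group law + chain rule at the current configuration); **`hasDerivAt_action_sunExpDrift_of_pairing`** — the
  same read through a represented force field: `= Σ_l B(D(e_ε(sp)·V)_l, p_l)`; `abs_sum_pairing_le`;
  `abs_action_sunExpDrift_sub_le` — mean value: `‖D(W)_l‖ ≤ D_max` gives
  `|S(e_ε(p)·V) − S(V)| ≤ βD_max·Σ_l‖p_l‖`; **`abs_action_sunExpDrift_sub_linear_le`** — FIRST-ORDER TAYLOR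
  WITH AN EXPLICIT SECOND-ORDER REMAINDER: `‖D(W) − D(W')‖ ≤ K‖coeConfig W − coeConfig W'‖` gives
  `|S(e_ε(p)·V) − S(V) − Σ_l B(D(V)_l, p_l)| ≤ ½N²C_ιβ|ε|·K·‖p‖·Σ_l‖p_l‖` — over one leapfrog drift the
  potential deviates from its linearisation by `O(ε²)` once `K = O(ε)`.

NOT CLAIMED: optimal constants (the `L²` operator norm would remove one factor `N`); anything when
`a ↦ S(e_ε(a)·W)` is not differentiable; which `B`, `D` the engine's autodiff realises in its coordinates
(a dictionary, not re-derived here); floating point; any number.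
-/

noncomputable section

namespace Summit.Ventures.LatticeQCDFlow.Exactness

open Set Function NormedSpace
open scoped Matrix Matrix.Norms.Operator

set_option backward.isDefEq.respectTransparency false

variable {n : Type*} [Fintype n] [DecidableEq n]
variable {E : Type*} [NormedAddCommGroup E] [NormedSpace ℝ E]
variable (ι : E →ₗ[ℝ] Matrix n n ℂ) (hι : ∀ a, (ι a)ᴴ = -ι a ∧ (ι a).trace = 0)
variable {L : Type*}

/-! ## §1 The drift in general coordinates: group law, and how far it moves a configuration in the matrix sup norm -/

section Drift

/-- `e_ε(0) = 1`. -/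
theorem sunExpDrift_zero (ε : ℝ) : sunExpDrift (L := L) ι hι ε 0 = 1 := by
  funext l
  simp only [sunExpDrift_apply, Pi.zero_apply, smul_zero, suExp_zero, Pi.one_apply]

/-- **The drift is a one-parameter group linkwise**: `e_ε((h+s)p) = e_ε(hp)·e_ε(sp)`. -/
theorem sunExpDrift_add_smul (ε : ℝ) (p : L → E) (h s : ℝ) :
    sunExpDrift ι hι ε ((h + s) • p) = sunExpDrift ι hι ε (h • p) * sunExpDrift ι hι ε (s • p) := by
  funext l
  simp only [sunExpDrift_apply, Pi.mul_apply, Pi.smul_apply]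
  rw [smul_comm ε (h + s) (p l), smul_comm ε h (p l), smul_comm ε s (p l)]
  -- parallel exponents commute
  apply Subtype.ext
  rw [Submonoid.coe_mul, coe_suExp, coe_suExp, coe_suExp,
    show ι ((h + s) • ε • p l) = h • ι (ε • p l) + s • ι (ε • p l) by rw [map_smul, add_smul],
    show ι (h • ε • p l) = h • ι (ε • p l) by rw [map_smul], show ι (s • ε • p l) = s • ι (ε • p l) by rw [map_smul]]
  exact Matrix.exp_add_of_commute (h • ι (ε • p l)) (s • ι (ε • p l)) (((Commute.refl (ι (ε • p l))).smul_left h).smul_right s)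

/-- **Some norm bound of the coordinate map always exists** (finite-dimensional coordinates):
`∃ C ≥ 0, ‖ι x‖_{∞-op} ≤ C‖x‖`. -/
theorem exists_norm_coords_le [FiniteDimensional ℝ E] : ∃ C : ℝ, 0 ≤ C ∧ ∀ x : E, ‖ι x‖ ≤ C * ‖x‖ :=
  ⟨‖LinearMap.toContinuousLinearMap ι‖, norm_nonneg _, fun x => (LinearMap.toContinuousLinearMap ι).le_opNorm x⟩

/-- Along `τ ↦ exp(τ ι a)` the derivative is `exp(τ ι a)·ι a`. -/
theorem hasDerivAt_coe_suExp_smul (a : E) (τ : ℝ) :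
    HasDerivAt (fun τ : ℝ => ((suExp ι hι (τ • a) : Matrix.specialUnitaryGroup n ℂ) : Matrix n n ℂ))
      (((suExp ι hι (τ • a) : Matrix.specialUnitaryGroup n ℂ) : Matrix n n ℂ) * ι a) τ := by
  have hfun : (fun τ : ℝ => ((suExp ι hι (τ • a) : Matrix.specialUnitaryGroup n ℂ) : Matrix n n ℂ)) =
      fun τ : ℝ => exp (τ • ι a) := by
    funext τ
    rw [coe_suExp, map_smul]
  rw [hfun, coe_suExp, map_smul]
  exact hasDerivAt_exp_smul_const (𝕂 := ℝ) (ι a) τ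

/-- **One link moves by at most `N·C_ι‖a‖·|t − t'|`**: `‖exp(t ι a) − exp(t' ι a)‖ ≤ N·C_ι‖a‖|t − t'|`
(`L∞` operator norm; mean value along the one-parameter group, `‖U‖ ≤ N` on `SU(N)`). -/
theorem norm_coe_suExp_smul_sub_le {Cι : ℝ} (hCι : ∀ x : E, ‖ι x‖ ≤ Cι * ‖x‖) (a : E) (t t' : ℝ) :
    ‖((suExp ι hι (t • a) : Matrix.specialUnitaryGroup n ℂ) : Matrix n n ℂ) -
        ((suExp ι hι (t' • a) : Matrix.specialUnitaryGroup n ℂ) : Matrix n n ℂ)‖ ≤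
      Fintype.card n * Cι * ‖a‖ * |t - t'| := by
  have hderiv : ∀ τ ∈ segment ℝ t' t, HasDerivWithinAt
      (fun τ : ℝ => ((suExp ι hι (τ • a) : Matrix.specialUnitaryGroup n ℂ) : Matrix n n ℂ))
      (((suExp ι hι (τ • a) : Matrix.specialUnitaryGroup n ℂ) : Matrix n n ℂ) * ι a) (segment ℝ t' t) τ :=
    fun τ _ => (hasDerivAt_coe_suExp_smul ι hι a τ).hasDerivWithinAt
  have hbound : ∀ τ ∈ segment ℝ t' t,
      ‖((suExp ι hι (τ • a) : Matrix.specialUnitaryGroup n ℂ) : Matrix n n ℂ) * ι a‖ ≤ Fintype.card n * Cι * ‖a‖ := by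
    intro τ _
    calc ‖((suExp ι hι (τ • a) : Matrix.specialUnitaryGroup n ℂ) : Matrix n n ℂ) * ι a‖
        ≤ ‖((suExp ι hι (τ • a) : Matrix.specialUnitaryGroup n ℂ) : Matrix n n ℂ)‖ * ‖ι a‖ := norm_mul_le _ _
      _ ≤ Fintype.card n * (Cι * ‖a‖) :=
          mul_le_mul (norm_le_card_of_mem_specialUnitaryGroup (suExp ι hι (τ • a)).2) (hCι a) (norm_nonneg _)
            (Nat.cast_nonneg _)
      _ = Fintype.card n * Cι * ‖a‖ := by ring
  have h := Convex.norm_image_sub_le_of_norm_hasDerivWithin_le hderiv hbound (convex_segment t' t)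
    (left_mem_segment ℝ t' t) (right_mem_segment ℝ t' t)
  calc _ ≤ Fintype.card n * Cι * ‖a‖ * ‖t - t'‖ := h
    _ = Fintype.card n * Cι * ‖a‖ * |t - t'| := by rw [Real.norm_eq_abs]

variable [Fintype L]

/-- **THE DRIFT MOVES A CONFIGURATION BY AT MOST `N²C_ι|ε|·‖p‖·|t − t'|` IN THE MATRIX SUP NORM**:
`‖coeConfig (e_ε(tp)·V) − coeConfig (e_ε(t'p)·V)‖ ≤ N²C_ι|ε|‖p‖|t − t'|`. -/
theorem norm_coeConfig_sunExpDrift_sub_le {Cι : ℝ} (hC0 : 0 ≤ Cι) (hCι : ∀ x : E, ‖ι x‖ ≤ Cι * ‖x‖) (ε : ℝ)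
    (V : L → Matrix.specialUnitaryGroup n ℂ) (p : L → E) (t t' : ℝ) :
    ‖coeConfig (sunExpDrift ι hι ε (t • p) * V) - coeConfig (sunExpDrift ι hι ε (t' • p) * V)‖ ≤
      (Fintype.card n : ℝ) ^ 2 * Cι * |ε| * ‖p‖ * |t - t'| := by
  refine (pi_norm_le_iff_of_nonneg (by positivity)).2 fun l => ?_
  rw [Pi.sub_apply, coeConfig_apply, coeConfig_apply, Pi.mul_apply, Pi.mul_apply, sunExpDrift_apply, sunExpDrift_apply,
    Pi.smul_apply, Pi.smul_apply, smul_comm ε t (p l), smul_comm ε t' (p l)]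
  rw [Submonoid.coe_mul, Submonoid.coe_mul, ← sub_mul]
  have hp : ‖ε • p l‖ ≤ |ε| * ‖p‖ := by
    rw [norm_smul, Real.norm_eq_abs]
    exact mul_le_mul_of_nonneg_left (norm_le_pi_norm p l) (abs_nonneg ε)
  calc ‖(((suExp ι hι (t • ε • p l) : Matrix.specialUnitaryGroup n ℂ) : Matrix n n ℂ) -
          ((suExp ι hι (t' • ε • p l) : Matrix.specialUnitaryGroup n ℂ) : Matrix n n ℂ)) *
          ((V l : Matrix.specialUnitaryGroup n ℂ) : Matrix n n ℂ)‖
      ≤ ‖((suExp ι hι (t • ε • p l) : Matrix.specialUnitaryGroup n ℂ) : Matrix n n ℂ) -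
          ((suExp ι hι (t' • ε • p l) : Matrix.specialUnitaryGroup n ℂ) : Matrix n n ℂ)‖ *
          ‖((V l : Matrix.specialUnitaryGroup n ℂ) : Matrix n n ℂ)‖ := norm_mul_le _ _
    _ ≤ (Fintype.card n * Cι * ‖ε • p l‖ * |t - t'|) * Fintype.card n :=
        mul_le_mul (norm_coe_suExp_smul_sub_le ι hι hCι _ t t') (norm_le_card_of_mem_specialUnitaryGroup (V l).2)
          (norm_nonneg _) (by positivity)
    _ ≤ (Fintype.card n * Cι * (|ε| * ‖p‖) * |t - t'|) * Fintype.card n := by gcongr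
    _ = (Fintype.card n : ℝ) ^ 2 * Cι * |ε| * ‖p‖ * |t - t'| := by ring

end Drift

/-! ## §2 The work identity along the drift for ANY action; a force field represented through a pairing; mean-value and first-order Taylor bounds -/

section Work

variable [Fintype L]

/-- **THE WORK IDENTITY along the drift, coordinate-free, for ANY action**: if `a ↦ S(e_ε(a)·W)` is
differentiable at `0` for every `W`, then `d/dt|_{t=s} S(e_ε(tp)·V) = D(a ↦ S(e_ε(a)·(e_ε(sp)·V)))(0)[p]`. -/
theorem hasDerivAt_action_sunExpDrift (S : (L → Matrix.specialUnitaryGroup n ℂ) → ℝ) (ε : ℝ)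
    (hd : ∀ W : L → Matrix.specialUnitaryGroup n ℂ, DifferentiableAt ℝ (fun a : L → E => S (sunExpDrift ι hι ε a * W)) 0)
    (V : L → Matrix.specialUnitaryGroup n ℂ) (p : L → E) (s : ℝ) :
    HasDerivAt (fun t : ℝ => S (sunExpDrift ι hι ε (t • p) * V))
      (fderiv ℝ (fun a : L → E => S (sunExpDrift ι hι ε a * (sunExpDrift ι hι ε (s • p) * V))) 0 p) s := by
  -- chain rule at the current configuration `W = e_ε(sp)·V`
  have hinner : HasDerivAt (fun t : ℝ => (t - s) • p) p s := by
    simpa using ((hasDerivAt_id s).sub_const s).smul_const p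
  have h0 : (fun t : ℝ => (t - s) • p) s = 0 := by simp
  have hG : HasFDerivAt (fun a : L → E => S (sunExpDrift ι hι ε a * (sunExpDrift ι hι ε (s • p) * V)))
      (fderiv ℝ (fun a : L → E => S (sunExpDrift ι hι ε a * (sunExpDrift ι hι ε (s • p) * V))) 0)
      ((fun t : ℝ => (t - s) • p) s) := by
    rw [h0]
    exact (hd _).hasFDerivAt
  have hfin := hG.comp_hasDerivAt s hinner
  have hfeq : (fun t : ℝ => S (sunExpDrift ι hι ε (t • p) * V)) =
      (fun a : L → E => S (sunExpDrift ι hι ε a * (sunExpDrift ι hι ε (s • p) * V))) ∘ fun t : ℝ => (t - s) • p := by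
    funext t
    simp only [Function.comp_apply]
    rw [← mul_assoc, ← sunExpDrift_add_smul ι hι ε p (t - s) s, sub_add_cancel]
  rw [hfeq]
  exact hfin

variable (B : E →ₗ[ℝ] E →ₗ[ℝ] ℝ)

/-- **THE WORK IDENTITY READ THROUGH A REPRESENTED FORCE FIELD**: if the differential of `a ↦ S(e_ε(a)·W)`
at `0` is `δ ↦ Σ_l B(D(W)_l, δ_l)` for every `W`, then
`d/dt|_{t=s} S(e_ε(tp)·V) = Σ_l B(D(e_ε(sp)·V)_l, p_l)`. -/
theorem hasDerivAt_action_sunExpDrift_of_pairing (S : (L → Matrix.specialUnitaryGroup n ℂ) → ℝ) (ε : ℝ)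
    (hd : ∀ W : L → Matrix.specialUnitaryGroup n ℂ, DifferentiableAt ℝ (fun a : L → E => S (sunExpDrift ι hι ε a * W)) 0)
    (D : (L → Matrix.specialUnitaryGroup n ℂ) → L → E)
    (hD : ∀ (W : L → Matrix.specialUnitaryGroup n ℂ) (δ : L → E),
      fderiv ℝ (fun a : L → E => S (sunExpDrift ι hι ε a * W)) 0 δ = ∑ l, B (D W l) (δ l))
    (V : L → Matrix.specialUnitaryGroup n ℂ) (p : L → E) (s : ℝ) :
    HasDerivAt (fun t : ℝ => S (sunExpDrift ι hι ε (t • p) * V))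
      (∑ l, B (D (sunExpDrift ι hι ε (s • p) * V) l) (p l)) s := by
  rw [← hD]
  exact hasDerivAt_action_sunExpDrift ι hι S ε hd V p s

omit [Fintype n] [DecidableEq n] in
/-- A bounded pairing summed over the links: `|Σ_l B(x_l, y_l)| ≤ β·(max_l ‖x_l‖)·Σ_l‖y_l‖` given
`‖x_l‖ ≤ X` for all `l`. -/
theorem abs_sum_pairing_le {β : ℝ} (hβ0 : 0 ≤ β) (hBβ : ∀ x y : E, |B x y| ≤ β * ‖x‖ * ‖y‖) {X : ℝ}
    (x y : L → E) (hx : ∀ l, ‖x l‖ ≤ X) : |∑ l, B (x l) (y l)| ≤ β * X * ∑ l, ‖y l‖ := by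
  refine (Finset.abs_sum_le_sum_abs _ _).trans ?_
  rw [Finset.mul_sum]
  refine Finset.sum_le_sum fun l _ => (hBβ _ _).trans ?_
  have := hx l
  gcongr

/-- **THE MEAN-VALUE BOUND ALONG A DRIFT**: with `‖D(W)_l‖ ≤ D_max` for all `W, l` and `|B(x,y)| ≤ β‖x‖‖y‖`,
`|S(e_ε(p)·V) − S(V)| ≤ βD_max · Σ_l ‖p_l‖`. -/
theorem abs_action_sunExpDrift_sub_le (S : (L → Matrix.specialUnitaryGroup n ℂ) → ℝ) (ε : ℝ)
    (hd : ∀ W : L → Matrix.specialUnitaryGroup n ℂ, DifferentiableAt ℝ (fun a : L → E => S (sunExpDrift ι hι ε a * W)) 0)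
    (D : (L → Matrix.specialUnitaryGroup n ℂ) → L → E)
    (hD : ∀ (W : L → Matrix.specialUnitaryGroup n ℂ) (δ : L → E),
      fderiv ℝ (fun a : L → E => S (sunExpDrift ι hι ε a * W)) 0 δ = ∑ l, B (D W l) (δ l))
    {β : ℝ} (hβ0 : 0 ≤ β) (hBβ : ∀ x y : E, |B x y| ≤ β * ‖x‖ * ‖y‖)
    {Dmax : ℝ} (hDb : ∀ (W : L → Matrix.specialUnitaryGroup n ℂ) (l : L), ‖D W l‖ ≤ Dmax)
    (V : L → Matrix.specialUnitaryGroup n ℂ) (p : L → E) :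
    |S (sunExpDrift ι hι ε p * V) - S V| ≤ β * Dmax * ∑ l, ‖p l‖ := by
  have hderiv : ∀ t ∈ Icc (0 : ℝ) 1, HasDerivWithinAt (fun t : ℝ => S (sunExpDrift ι hι ε (t • p) * V))
      ((fun t : ℝ => ∑ l, B (D (sunExpDrift ι hι ε (t • p) * V) l) (p l)) t) (Icc (0 : ℝ) 1) t :=
    fun t _ => (hasDerivAt_action_sunExpDrift_of_pairing ι hι B S ε hd D hD V p t).hasDerivWithinAt
  have hbound : ∀ t ∈ Ico (0 : ℝ) 1,
      ‖(fun t : ℝ => ∑ l, B (D (sunExpDrift ι hι ε (t • p) * V) l) (p l)) t‖ ≤ β * Dmax * ∑ l, ‖p l‖ := by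
    intro t _
    rw [Real.norm_eq_abs]
    exact abs_sum_pairing_le B hβ0 hBβ _ _ fun l => hDb _ l
  have h := norm_image_sub_le_of_norm_deriv_le_segment' hderiv hbound 1 (right_mem_Icc.2 zero_le_one)
  simp only [one_smul, zero_smul, sunExpDrift_zero, one_mul, sub_zero, mul_one] at h
  rw [Real.norm_eq_abs] at h
  exact h

/-- **FIRST-ORDER TAYLOR ALONG THE DRIFT WITH AN EXPLICIT SECOND-ORDER REMAINDER**: if the represented force
field is `K`-Lipschitz in the matrix sup norm, `‖D(W) − D(W')‖ ≤ K‖coeConfig W − coeConfig W'‖`, then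
`|S(e_ε(p)·V) − S(V) − Σ_l B(D(V)_l, p_l)| ≤ ½N²C_ιβ|ε|·K·‖p‖·Σ_l‖p_l‖` — over one leapfrog drift the
potential deviates from its linearisation by `O(ε²)` once `K = O(ε)` (§1: the drift moves the field by
`≤ N²C_ι|ε|‖p‖`). -/
theorem abs_action_sunExpDrift_sub_linear_le {Cι : ℝ} (hC0 : 0 ≤ Cι) (hCι : ∀ x : E, ‖ι x‖ ≤ Cι * ‖x‖)
    (S : (L → Matrix.specialUnitaryGroup n ℂ) → ℝ) (ε : ℝ)
    (hd : ∀ W : L → Matrix.specialUnitaryGroup n ℂ, DifferentiableAt ℝ (fun a : L → E => S (sunExpDrift ι hι ε a * W)) 0)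
    (D : (L → Matrix.specialUnitaryGroup n ℂ) → L → E)
    (hD : ∀ (W : L → Matrix.specialUnitaryGroup n ℂ) (δ : L → E),
      fderiv ℝ (fun a : L → E => S (sunExpDrift ι hι ε a * W)) 0 δ = ∑ l, B (D W l) (δ l))
    {β : ℝ} (hβ0 : 0 ≤ β) (hBβ : ∀ x y : E, |B x y| ≤ β * ‖x‖ * ‖y‖)
    {K : ℝ} (hK0 : 0 ≤ K)
    (hK : ∀ W W' : L → Matrix.specialUnitaryGroup n ℂ, ‖D W - D W'‖ ≤ K * ‖coeConfig W - coeConfig W'‖)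
    (V : L → Matrix.specialUnitaryGroup n ℂ) (p : L → E) :
    |S (sunExpDrift ι hι ε p * V) - S V - ∑ l, B (D V l) (p l)| ≤
      (Fintype.card n : ℝ) ^ 2 * Cι * β * |ε| * K * ‖p‖ * (∑ l, ‖p l‖) / 2 := by
  -- the path, its derivative φ and φ's Lipschitz constant
  set f : ℝ → ℝ := fun t => S (sunExpDrift ι hι ε (t • p) * V) with hf
  set φ : ℝ → ℝ := fun t => ∑ l, B (D (sunExpDrift ι hι ε (t • p) * V) l) (p l) with hφ
  set Lφ : ℝ := (Fintype.card n : ℝ) ^ 2 * Cι * β * |ε| * K * ‖p‖ * ∑ l, ‖p l‖ with hL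
  have hderiv : ∀ t, HasDerivAt f (φ t) t := fun t => hasDerivAt_action_sunExpDrift_of_pairing ι hι B S ε hd D hD V p t
  have hLip : ∀ t t' : ℝ, |φ t - φ t'| ≤ Lφ * |t - t'| := by
    intro t t'
    rw [hφ]
    simp only
    rw [← Finset.sum_sub_distrib]
    have hdist := norm_coeConfig_sunExpDrift_sub_le ι hι hC0 hCι ε V p t t'
    have hKtt := (hK (sunExpDrift ι hι ε (t • p) * V) (sunExpDrift ι hι ε (t' • p) * V)).trans
      (mul_le_mul_of_nonneg_left hdist hK0)
    have hl : ∀ l, ‖D (sunExpDrift ι hι ε (t • p) * V) l - D (sunExpDrift ι hι ε (t' • p) * V) l‖ ≤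
        K * ((Fintype.card n : ℝ) ^ 2 * Cι * |ε| * ‖p‖ * |t - t'|) := fun l =>
      (norm_le_pi_norm (D (sunExpDrift ι hι ε (t • p) * V) - D (sunExpDrift ι hι ε (t' • p) * V)) l).trans hKtt
    calc |∑ l, (B (D (sunExpDrift ι hι ε (t • p) * V) l) (p l) - B (D (sunExpDrift ι hι ε (t' • p) * V) l) (p l))|
        = |∑ l, B (D (sunExpDrift ι hι ε (t • p) * V) l - D (sunExpDrift ι hι ε (t' • p) * V) l) (p l)| := by
          congr 1
          exact Finset.sum_congr rfl fun l _ => (LinearMap.map_sub₂ B _ _ _).symm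
      _ ≤ β * (K * ((Fintype.card n : ℝ) ^ 2 * Cι * |ε| * ‖p‖ * |t - t'|)) * ∑ l, ‖p l‖ :=
          abs_sum_pairing_le B hβ0 hBβ _ _ hl
      _ = Lφ * |t - t'| := by rw [hL]; ring
  have hL0 : 0 ≤ Lφ := by rw [hL]; positivity
  -- values at the endpoints
  have hf0 : f 0 = S V := by
    rw [hf]
    simp only [zero_smul, sunExpDrift_zero, one_mul]
  have hf1 : f 1 = S (sunExpDrift ι hι ε p * V) := by
    rw [hf]
    simp only [one_smul]
  have hφ0 : φ 0 = ∑ l, B (D V l) (p l) := by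
    rw [hφ]
    simp only [zero_smul, sunExpDrift_zero, one_mul]
  -- comparison functions G (upper) and H (lower)
  have hG : ∀ t, HasDerivAt (fun x => f x - x * φ 0 - Lφ / 2 * (x * x)) (φ t - φ 0 - Lφ * t) t := by
    intro t
    have h1 := ((hderiv t).sub (hasDerivAt_mul_const (φ 0))).sub
      (((hasDerivAt_id' t).mul (hasDerivAt_id' t)).const_mul (Lφ / 2))
    exact h1.congr_deriv (by ring)
  have hH : ∀ t, HasDerivAt (fun x => f x - x * φ 0 + Lφ / 2 * (x * x)) (φ t - φ 0 + Lφ * t) t := by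
    intro t
    have h1 := ((hderiv t).sub (hasDerivAt_mul_const (φ 0))).add
      (((hasDerivAt_id' t).mul (hasDerivAt_id' t)).const_mul (Lφ / 2))
    exact h1.congr_deriv (by ring)
  have hGmono : (fun x => f x - x * φ 0 - Lφ / 2 * (x * x)) 1 - (fun x => f x - x * φ 0 - Lφ / 2 * (x * x)) 0 ≤ 0 * (1 - 0) := by
    refine (convex_Icc (0 : ℝ) 1).image_sub_le_mul_sub_of_deriv_le
      (fun t _ => (hG t).continuousAt.continuousWithinAt) (fun t _ => (hG t).differentiableAt.differentiableWithinAt)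
      (fun t ht => ?_) 0 (left_mem_Icc.2 zero_le_one) 1 (right_mem_Icc.2 zero_le_one) zero_le_one
    rw [interior_Icc] at ht
    rw [(hG t).deriv]
    have := hLip t 0
    rw [sub_zero, abs_of_pos ht.1] at this
    linarith [le_abs_self (φ t - φ 0)]
  have hHmono : 0 * (1 - 0) ≤ (fun x => f x - x * φ 0 + Lφ / 2 * (x * x)) 1 - (fun x => f x - x * φ 0 + Lφ / 2 * (x * x)) 0 := by
    refine (convex_Icc (0 : ℝ) 1).mul_sub_le_image_sub_of_le_deriv
      (fun t _ => (hH t).continuousAt.continuousWithinAt) (fun t _ => (hH t).differentiableAt.differentiableWithinAt)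
      (fun t ht => ?_) 0 (left_mem_Icc.2 zero_le_one) 1 (right_mem_Icc.2 zero_le_one) zero_le_one
    rw [interior_Icc] at ht
    rw [(hH t).deriv]
    have := hLip t 0
    rw [sub_zero, abs_of_pos ht.1] at this
    linarith [neg_abs_le (φ t - φ 0)]
  norm_num at hGmono hHmono
  rw [← hf1, ← hf0, ← hφ0, abs_le]
  have hL2 : Lφ / 2 = (Fintype.card n : ℝ) ^ 2 * Cι * β * |ε| * K * ‖p‖ * (∑ l, ‖p l‖) / 2 := by rw [hL]
  constructor <;> linarith [hGmono, hHmono]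

end Work

end Summit.Ventures.LatticeQCDFlow.Exactness
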